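import Mathlib

/-!
# PercRepro — the truncation of a finite matroid to rank `p` (typer-2, gen 6)

This Mathlib has no truncation (checked: nothing under `Combinatorics/Matroid/`); mine-2's THEOREM K
(`proofs/MINE2-RLS.md` §11: the rank level-set inequality (RLS)`(p, q)` for every matroid follows from the rank-`p`
case, because truncating to rank `p` leaves `Y(p, q)` unchanged and only enlarges `U(p, q)`) needs it. Here:

* **`truncate M p`** — the matroid on `M.E` whose independent sets are the independent sets of `M` with at most
  `p` elements (`IndepMatroid.ofFinite`; augmentation = `M`'s augmentation, the new set has `≤ |J| ≤ p` elements);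
* `truncate_indep_iff`, `truncate_ground`, `truncate_finite`;
* **`truncate_eRk`** — `(truncate M p).eRk X = min (M.eRk X) p`, hence **`truncate_eRank`** and
  **`truncate_eRk_eq_of_le`** (`M.eRk X ≤ p` ⇒ the rank is unchanged) / **`truncate_eRk_eq_of_ge`**;
* **`truncate_middle_eq`**, **`top_subset_truncate_top`**, **`rls_of_truncate`** — THEOREM K: `c · #U ≤ #Y` for
  `truncate M p` implies it for `M` (the level sets in the spelling of `C025`: the middle level set is unchanged,
  the top one only grows), so (RLS)`(p, q)` for all matroids follows from the rank-`≤ p` case.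
-/

namespace PercRepro

open Set

namespace Matroid

variable {α : Type*}

/-- **The truncation of `M` to rank `p`**: the independent sets of `M` with at most `p` elements. -/
noncomputable def truncate (M : _root_.Matroid α) [M.Finite] (p : ℕ) : _root_.Matroid α :=
  (IndepMatroid.ofFinite M.ground_finite (fun I => M.Indep I ∧ I.ncard ≤ p)
    ⟨M.empty_indep, by simp⟩
    (fun I J hJ hIJ => ⟨hJ.1.subset hIJ,
      (Set.ncard_le_ncard hIJ (M.ground_finite.subset hJ.1.subset_ground)).trans hJ.2⟩)
    (fun I J hI hJ hlt => by
      have hIfin : I.Finite := M.ground_finite.subset hI.1.subset_ground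
      have hJfin : J.Finite := M.ground_finite.subset hJ.1.subset_ground
      obtain ⟨e, he, hind⟩ := hI.1.exists_insert_of_encard_lt hJ.1 (by
        rw [← hIfin.cast_ncard_eq, ← hJfin.cast_ncard_eq]
        exact_mod_cast hlt)
      refine ⟨e, he.1, he.2, hind, ?_⟩
      rw [Set.ncard_insert_of_notMem he.2 hIfin]
      omega)
    (fun I hI => hI.1.subset_ground)).matroid

variable (M : _root_.Matroid α) [M.Finite] (p : ℕ)

/-- The independent sets of the truncation. -/
@[simp] theorem truncate_indep_iff {I : Set α} :
    (truncate M p).Indep I ↔ M.Indep I ∧ I.ncard ≤ p := by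
  simp [truncate]

/-- The truncation has the ground set of `M`. -/
@[simp] theorem truncate_ground : (truncate M p).E = M.E := rfl

/-- The truncation of a finite matroid is finite. -/
instance truncate_finite : (truncate M p).Finite := ⟨M.ground_finite⟩

/-- Every independent set of the truncation is independent in `M`. -/
theorem Indep.of_truncate {I : Set α} (h : (truncate M p).Indep I) : M.Indep I :=
  ((truncate_indep_iff M p).mp h).1

/-- The rank of the truncation is at most `p`. -/
theorem truncate_eRk_le (X : Set α) : (truncate M p).eRk X ≤ p := by
  rw [_root_.Matroid.eRk_le_iff]
  intro I _ hI
  rw [truncate_indep_iff] at hI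
  have hIfin : I.Finite := M.ground_finite.subset hI.1.subset_ground
  rw [← hIfin.cast_ncard_eq]
  exact_mod_cast hI.2

/-- The rank of the truncation is at most the rank in `M`. -/
theorem truncate_eRk_le_eRk (X : Set α) : (truncate M p).eRk X ≤ M.eRk X := by
  rw [_root_.Matroid.eRk_le_iff]
  intro I hIX hI
  rw [← (Indep.of_truncate M p hI).eRk_eq_encard]
  exact M.eRk_mono hIX

/-- **The rank of the truncation**: `(truncate M p).eRk X = min (M.eRk X) p`. -/
theorem truncate_eRk (X : Set α) : (truncate M p).eRk X = min (M.eRk X) p := by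
  refine le_antisymm (le_min (truncate_eRk_le_eRk M p X) (truncate_eRk_le M p X)) ?_
  -- a basis `J` of `X` in `M` and a subset of it of size `min (|J|) p`
  obtain ⟨J, hJ⟩ := M.exists_isBasis' X
  have hJfin : J.Finite := M.ground_finite.subset hJ.indep.subset_ground
  have hJr : J.encard = M.eRk X := hJ.encard_eq_eRk
  have hmin : min (M.eRk X) (p : ℕ∞) ≤ J.encard := by rw [hJr]; exact min_le_left _ _
  obtain ⟨I, hIJ, hIcard⟩ := Set.exists_subset_encard_eq hmin
  have hIfin : I.Finite := hJfin.subset hIJ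
  rw [_root_.Matroid.le_eRk_iff]
  refine ⟨I, hIJ.trans hJ.subset, ?_, hIcard⟩
  rw [truncate_indep_iff]
  refine ⟨hJ.indep.subset hIJ, ?_⟩
  have h : (I.ncard : ℕ∞) ≤ p := by
    rw [hIfin.cast_ncard_eq, hIcard]
    exact min_le_right _ _
  exact_mod_cast h

/-- The truncation has rank `min (rank M) p`. -/
theorem truncate_eRank : (truncate M p).eRank = min M.eRank p := by
  rw [_root_.Matroid.eRank_def, truncate_ground, truncate_eRk, _root_.Matroid.eRank_def]

/-- Below rank `p` the truncation does not change the rank. -/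
theorem truncate_eRk_eq_of_le {X : Set α} (h : M.eRk X ≤ p) : (truncate M p).eRk X = M.eRk X := by
  rw [truncate_eRk, min_eq_left h]

/-- Above rank `p` the truncation has rank `p`. -/
theorem truncate_eRk_eq_of_ge {X : Set α} (h : (p : ℕ∞) ≤ M.eRk X) : (truncate M p).eRk X = p := by
  rw [truncate_eRk, min_eq_right h]

/-! ### Theorem K: the level sets of the truncation -/

/-- **The middle level set is unchanged by truncation**: `{A ⊆ E : q < r(A) < p}` is the same for `M` and
`truncate M p`. -/
theorem truncate_middle_eq (q : ℕ) :
    {A : Set α | A ⊆ (truncate M p).E ∧ (q : ℕ∞) < (truncate M p).eRk A ∧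
        (truncate M p).eRk A < (p : ℕ∞)} =
      {A : Set α | A ⊆ M.E ∧ (q : ℕ∞) < M.eRk A ∧ M.eRk A < (p : ℕ∞)} := by
  ext A
  simp only [Set.mem_setOf_eq, truncate_ground, truncate_eRk, lt_min_iff, min_lt_iff, lt_self_iff_false,
    or_false]
  constructor
  · rintro ⟨hA, ⟨h1, _⟩, h2⟩
    exact ⟨hA, h1, h2⟩
  · rintro ⟨hA, h1, h2⟩
    exact ⟨hA, ⟨h1, h1.trans h2⟩, h2⟩

/-- **The top level set only grows under truncation** (`q < p`): `{A : r(A) = p, r(E ∖ A) = q}` of `M` is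
contained in the same set for `truncate M p`. -/
theorem top_subset_truncate_top {q : ℕ} (hqp : q < p) :
    {A : Set α | A ⊆ M.E ∧ M.eRk A = (p : ℕ∞) ∧ M.eRk (M.E \ A) = (q : ℕ∞)} ⊆
      {A : Set α | A ⊆ (truncate M p).E ∧ (truncate M p).eRk A = (p : ℕ∞) ∧
        (truncate M p).eRk ((truncate M p).E \ A) = (q : ℕ∞)} := by
  intro A hA
  obtain ⟨hAE, hr, hr'⟩ := hA
  refine ⟨hAE, ?_, ?_⟩
  · rw [truncate_eRk, hr, min_self]
  · rw [truncate_ground, truncate_eRk, hr', min_eq_left]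
    exact_mod_cast hqp.le

/-- **Theorem K** (mine-2 §11, the transfer): if `c · #U ≤ #Y` holds for `truncate M p` then it holds for `M`
(`U`, `Y` in the spelling of `C025`; `c ≥ 0`, `q < p`). So the rank level-set inequality for all matroids follows
from the case of rank `≤ p`. -/
theorem rls_of_truncate {q : ℕ} (hqp : q < p) (c : ℚ) (hc : 0 ≤ c)
    (h : c * ({A : Set α | A ⊆ (truncate M p).E ∧ (truncate M p).eRk A = (p : ℕ∞) ∧
          (truncate M p).eRk ((truncate M p).E \ A) = (q : ℕ∞)}.ncard : ℚ) ≤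
        ({A : Set α | A ⊆ (truncate M p).E ∧ (q : ℕ∞) < (truncate M p).eRk A ∧
          (truncate M p).eRk A < (p : ℕ∞)}.ncard : ℚ)) :
    c * ({A : Set α | A ⊆ M.E ∧ M.eRk A = (p : ℕ∞) ∧ M.eRk (M.E \ A) = (q : ℕ∞)}.ncard : ℚ) ≤
      ({A : Set α | A ⊆ M.E ∧ (q : ℕ∞) < M.eRk A ∧ M.eRk A < (p : ℕ∞)}.ncard : ℚ) := by
  rw [truncate_middle_eq] at h
  refine le_trans ?_ h
  refine mul_le_mul_of_nonneg_left ?_ hc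
  have hfin : {A : Set α | A ⊆ (truncate M p).E ∧ (truncate M p).eRk A = (p : ℕ∞) ∧
      (truncate M p).eRk ((truncate M p).E \ A) = (q : ℕ∞)}.Finite :=
    M.ground_finite.finite_subsets.subset fun A hA => hA.1
  exact_mod_cast Set.ncard_le_ncard (top_subset_truncate_top M p hqp) hfin

end Matroid

end PercRepro
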